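import Summits.ValiantsHypothesis.ValiantsHypothesis.Theorems.SymPencilEquivariantSdcNotQPProjectivePermDichotomy
import Mathlib.GroupTheory.SpecificGroups.Alternating.Centralizer
import Mathlib.GroupTheory.Abelianization.Defs
import HarnessLib

/-!
# ValiantsHypothesis / SymPencil — crux `EquivariantSdcNotQP` (stmt-ValiantsHypothesis-17792), line
# `birth_EquivariantSdcNotQP`, stub `stub_permify`: the spin dichotomy (H1) at the level of
# `𝔖_n × 𝔖_n`, PROVED

Helper of the item (`--supports stmt-ValiantsHypothesis-17792 --as helper`; 0 definitions, 0 named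
facts).  The reduction `…PermEmbeddingOfYoungBounds.lean` (val-lit-p6 g12) left the residue (D) of
`stub_permify` resting on two hypotheses (H1) *spin dichotomy* and (H2) *Young fixed vectors*, and
applies (H1) to the index-`4` subgroup `φ⁻¹(𝔄_n × 𝔄_n)` of a group `G` given with a surjection
`φ : G ↠ 𝔖_n × 𝔖_n`.  This file PROVES (H1) in exactly that situation
(**`spinDichotomy_symmetric`**, with the constant `a = 4`): for `φ : G ↠ 𝔖_n × 𝔖_n` and a
representation `ρ : G →* GL_k(ℂ)` scalar on `ker φ`, either `n ≤ 4 (log₂ k + 1)`, or the central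
character of `ρ` on `ker φ` extends to a linear character `θ` of `φ⁻¹(𝔄_n × 𝔄_n)`.

Proof.  By `projective_perm_dichotomy` (`…ProjectivePermDichotomy.lean`: Schur's normalisation of
the Coxeter generators + the tree's universal property of `𝔖_n` + the Clifford degree bound)
applied to `φ⁻¹(𝔖_n × 1) ↠ 𝔖_n` and `φ⁻¹(1 × 𝔖_n) ↠ 𝔖_n`, either `n ≤ 4 (log₂ k + 1)` or there are
genuine representations `ρ₁, ρ₂ : 𝔖_n →* GL_k(ℂ)` with `ρ(g) = c_g · ρ₁(x) ρ₂(y)` for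
`φ(g) = (x, y)`.  The commutator `[ρ₁(x), ρ₂(y)]` is a scalar, multiplicative in `x`, hence a
character of `𝔖_n`, hence trivial on the perfect group `𝔄_n` (`n ≥ 5`, Mathlib's
`commutator_alternatingGroup_eq_self`); so `g ↦ ρ₁(x) ρ₂(y)` is multiplicative on
`φ⁻¹(𝔄_n × 𝔖_n)` and `θ(g) = c_g` is the required character.  (The statement is made at the
`𝔖_n × 𝔖_n` level because that is what the line uses and because it is provable uniformly in `n`:
the Schur multiplier of `𝔖_n` is detected by the commutator of two disjoint transpositions, whereas
`M(𝔄_6) = M(𝔄_7) = ℤ/6`.)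

Honest framing: a classical theorem (Schur 1911); `stub_permify`, the crux
`SymPencil.EquivariantSdcNotQP` and `VP ≠ VNP` remain OPEN and nothing here is progress on them.
-/

noncomputable section

set_option linter.dupNamespace false

namespace Summit.ValiantsHypothesis.ValiantsHypothesis.Theorems.SymPencilEquivariantSdcNotQP.SpinDichotomy

open Matrix Equiv

variable {k : ℕ}

/-- A scalar is determined by its action on a unit of `M_k(ℂ)`, `k ≥ 1`. [folklore] -/
theorem smul_unit_injective (hk : 1 ≤ k) (u : GL (Fin k) ℂ) {c d : ℂ}
    (h : c • (u : Matrix (Fin k) (Fin k) ℂ) = d • (u : Matrix (Fin k) (Fin k) ℂ)) :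
    c = d := by
  have h' := congrArg (· * ((u⁻¹ : GL (Fin k) ℂ) : Matrix (Fin k) (Fin k) ℂ)) h
  simp only [Matrix.smul_mul, Units.mul_inv] at h'
  exact smul_one_injective hk h'

/-- One factor of a projective representation of `𝔖_n × 𝔖_n`: the restriction to
`φ⁻¹(𝔖_n × 1)` (`i = fst`) or `φ⁻¹(1 × 𝔖_n)` is projectively linear unless `n ≤ 4 (log₂ k + 1)`.
[folklore] -/
theorem factor_dichotomy (hk : 1 ≤ k) {G : Type*} [Group G] {n : ℕ}
    (φ : G →* Perm (Fin n) × Perm (Fin n)) (ρ : G →* GL (Fin k) ℂ)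
    (hφ : Function.Surjective φ)
    (hker : ∀ g : G, φ g = 1 → ∃ c : ℂ,
      (ρ g : Matrix (Fin k) (Fin k) ℂ) = c • (1 : Matrix (Fin k) (Fin k) ℂ))
    (π π' : Perm (Fin n) × Perm (Fin n) →* Perm (Fin n))
    (ι : Perm (Fin n) →* Perm (Fin n) × Perm (Fin n))
    (hπι : ∀ x, π (ι x) = x) (hπ'ι : ∀ x, π' (ι x) = 1)
    (hext : ∀ p : Perm (Fin n) × Perm (Fin n), π p = 1 → π' p = 1 → p = 1) :
    n ≤ 4 * (Nat.log 2 k + 1) ∨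
      ∃ ρ₁ : Perm (Fin n) →* GL (Fin k) ℂ, ∀ g : G, π' (φ g) = 1 → ∃ c : ℂ,
        c ≠ 0 ∧ (ρ g : Matrix (Fin k) (Fin k) ℂ) =
          c • (ρ₁ (π (φ g)) : Matrix (Fin k) (Fin k) ℂ) := by
  set G₁ : Subgroup G := (π'.comp φ).ker with hG₁
  set φ₁ : G₁ →* Perm (Fin n) := π.comp (φ.comp G₁.subtype) with hφ₁
  have hφ₁_surj : Function.Surjective φ₁ := by
    intro x
    obtain ⟨g, hg⟩ := hφ (ι x)
    have hg₁ : g ∈ G₁ := by rw [hG₁, MonoidHom.mem_ker, MonoidHom.comp_apply, hg, hπ'ι]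
    exact ⟨⟨g, hg₁⟩, by
      simp only [hφ₁, MonoidHom.comp_apply, Subgroup.coe_subtype, hg, hπι]⟩
  have hker₁ : ∀ g : G₁, φ₁ g = 1 → ∃ c : ℂ,
      ((ρ.comp G₁.subtype) g : Matrix (Fin k) (Fin k) ℂ) =
        c • (1 : Matrix (Fin k) (Fin k) ℂ) := by
    intro g hg
    apply hker
    have h2 : π' (φ g) = 1 := MonoidHom.mem_ker.mp g.2
    exact hext _ hg h2
  rcases projective_perm_dichotomy hk φ₁ (ρ.comp G₁.subtype) hφ₁_surj hker₁ with
    h | ⟨ρ₁, hρ₁⟩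
  · exact Or.inl h
  · refine Or.inr ⟨ρ₁, fun g hg => ?_⟩
    have hg₁ : g ∈ G₁ := by rw [hG₁, MonoidHom.mem_ker, MonoidHom.comp_apply, hg]
    obtain ⟨c, hc0, hc⟩ := hρ₁ ⟨g, hg₁⟩
    exact ⟨c, hc0, hc⟩

/-- **(H1) at the level of `𝔖_n × 𝔖_n` — the spin dichotomy, PROVED (constant `a = 4`).**  For a
surjection `φ : G ↠ 𝔖_n × 𝔖_n` and a representation `ρ : G →* GL_k(ℂ)` that is scalar on `ker φ`:
either `n ≤ 4 (log₂ k + 1)`, or there is a linear character `θ` of `φ⁻¹(𝔄_n × 𝔄_n)` with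
`ρ(g) = θ(g) · 1` for `g ∈ ker φ`.  (Schur 1911: `M(𝔖_n) = ℤ/2` detected on two disjoint
transpositions, spin representations have degree `≥ 2^{⌊n/4⌋}` in the crude form used here, and
the mixed `sgn ⊗ sgn` class of `𝔖_n × 𝔖_n` dies on `𝔄_n × 𝔄_n` by perfectness of `𝔄_n`,
`n ≥ 5`.) [folklore] -/
theorem spinDichotomy_symmetric {G : Type*} [Group G] {n k : ℕ}
    (φ : G →* Perm (Fin n) × Perm (Fin n)) (ρ : G →* GL (Fin k) ℂ)
    (hφ : Function.Surjective φ)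
    (hker : ∀ g : G, φ g = 1 → ∃ c : ℂ,
      (ρ g : Matrix (Fin k) (Fin k) ℂ) = c • (1 : Matrix (Fin k) (Fin k) ℂ)) :
    n ≤ 4 * (Nat.log 2 k + 1) ∨
      ∃ θ : ↥(((alternatingGroup (Fin n)).prod (alternatingGroup (Fin n))).comap φ) →* ℂˣ,
        ∀ g : ↥(((alternatingGroup (Fin n)).prod (alternatingGroup (Fin n))).comap φ),
          φ g = 1 → ((ρ g : GL (Fin k) ℂ) : Matrix (Fin k) (Fin k) ℂ) =
            ((θ g : ℂˣ) : ℂ) • (1 : Matrix (Fin k) (Fin k) ℂ) := by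
  classical
  set AA : Subgroup (Perm (Fin n) × Perm (Fin n)) :=
    (alternatingGroup (Fin n)).prod (alternatingGroup (Fin n)) with hAA
  set G₀ : Subgroup G := AA.comap φ with hG₀
  -- `k = 0`: all `0 × 0` matrices coincide
  rcases Nat.eq_zero_or_pos k with hk0 | hk
  · subst hk0
    refine Or.inr ⟨1, fun g _ => ?_⟩
    ext i j; exact Fin.elim0 i
  -- small `n`
  by_cases hn : n ≤ 4
  · left
    calc n ≤ 4 := hn
      _ ≤ 4 * (Nat.log 2 k + 1) := Nat.le_mul_of_pos_right _ (Nat.succ_pos _)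
  have hn5 : 5 ≤ n := by omega
  -- the two factors
  have hext1 : ∀ p : Perm (Fin n) × Perm (Fin n), MonoidHom.fst _ _ p = 1 →
      MonoidHom.snd _ _ p = 1 → p = 1 := fun p h1 h2 => Prod.ext h1 h2
  have hext2 : ∀ p : Perm (Fin n) × Perm (Fin n), MonoidHom.snd _ _ p = 1 →
      MonoidHom.fst _ _ p = 1 → p = 1 := fun p h1 h2 => Prod.ext h2 h1
  rcases factor_dichotomy hk φ ρ hφ hker (MonoidHom.fst _ _) (MonoidHom.snd _ _)
    (MonoidHom.inl _ _)
    (fun x => rfl) (fun x => rfl) hext1 with h | ⟨ρ₁, hρ₁⟩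
  · exact Or.inl h
  rcases factor_dichotomy hk φ ρ hφ hker (MonoidHom.snd _ _) (MonoidHom.fst _ _)
    (MonoidHom.inr _ _)
    (fun x => rfl) (fun x => rfl) hext2 with h | ⟨ρ₂, hρ₂⟩
  · exact Or.inl h
  right
  simp only [MonoidHom.coe_fst, MonoidHom.coe_snd] at hρ₁ hρ₂
  -- `ρ g = c_g • ρ₁ x ρ₂ y`
  have hρ : ∀ g : G, ∃ c : ℂ, c ≠ 0 ∧ (ρ g : Matrix (Fin k) (Fin k) ℂ) =
      c • ((ρ₁ (φ g).1 : Matrix (Fin k) (Fin k) ℂ) *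
        (ρ₂ (φ g).2 : Matrix (Fin k) (Fin k) ℂ)) := by
    intro g
    obtain ⟨g₁, hg₁⟩ := hφ ((φ g).1, 1)
    have hg₂ : φ (g₁⁻¹ * g) = (1, (φ g).2) := by
      rw [map_mul, map_inv, hg₁]; ext <;> simp
    obtain ⟨c₁, hc₁0, hc₁⟩ := hρ₁ g₁ (by rw [hg₁])
    obtain ⟨c₂, hc₂0, hc₂⟩ := hρ₂ (g₁⁻¹ * g) (by rw [hg₂])
    rw [hg₁] at hc₁
    rw [hg₂] at hc₂
    refine ⟨c₁ * c₂, mul_ne_zero hc₁0 hc₂0, ?_⟩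
    have e : g = g₁ * (g₁⁻¹ * g) := by rw [mul_inv_cancel_left]
    rw [e, map_mul, Units.val_mul, hc₁, hc₂, Matrix.smul_mul, Matrix.mul_smul, smul_smul, ← e]
  -- the commutator `[ρ₁ x, ρ₂ y]` is a scalar
  have hω : ∀ x y : Perm (Fin n), ∃ ω : ℂ, (ρ₁ x : Matrix (Fin k) (Fin k) ℂ) * ρ₂ y =
      ω • ((ρ₂ y : Matrix (Fin k) (Fin k) ℂ) * ρ₁ x) := by
    intro x y
    obtain ⟨g₁, hg₁⟩ := hφ (x, 1)
    obtain ⟨g₂, hg₂⟩ := hφ (1, y)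
    obtain ⟨c₁, hc₁0, hc₁⟩ := hρ g₁
    obtain ⟨c₂, hc₂0, hc₂⟩ := hρ g₂
    rw [hg₁] at hc₁
    rw [hg₂] at hc₂
    simp only [map_one, Units.val_one, Matrix.mul_one, Matrix.one_mul] at hc₁ hc₂
    have hw : φ (g₁ * g₂ * g₁⁻¹ * g₂⁻¹) = 1 := by
      simp only [map_mul, map_inv, hg₁, hg₂]; ext <;> simp
    obtain ⟨ω, hωw⟩ := hker _ hw
    refine ⟨ω, ?_⟩
    -- `ρ(g₁ g₂) = ω • ρ(g₂ g₁)`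
    have e1 : (ρ (g₁ * g₂) : Matrix (Fin k) (Fin k) ℂ) =
        ω • (ρ (g₂ * g₁) : Matrix (Fin k) (Fin k) ℂ) := by
      have e : g₁ * g₂ = (g₁ * g₂ * g₁⁻¹ * g₂⁻¹) * (g₂ * g₁) := by group
      rw [e, map_mul, Units.val_mul, hωw, Matrix.smul_mul, Matrix.one_mul]
    rw [map_mul, map_mul, Units.val_mul, Units.val_mul, hc₁, hc₂, Matrix.smul_mul,
      Matrix.mul_smul, Matrix.smul_mul, Matrix.mul_smul, smul_smul, smul_smul, smul_smul] at e1
    have hcc : c₁ * c₂ ≠ 0 := mul_ne_zero hc₁0 hc₂0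
    have e2 : (c₁ * c₂) • ((ρ₁ x : Matrix (Fin k) (Fin k) ℂ) * ρ₂ y) =
        (c₁ * c₂) • (ω • ((ρ₂ y : Matrix (Fin k) (Fin k) ℂ) * ρ₁ x)) := by
      rw [e1, smul_smul]; congr 1; ring
    exact smul_right_injective _ hcc e2
  -- for fixed `y`, `x ↦ ω(x, y)` is a character of `𝔖_n`, trivial on `𝔄_n`
  have hcommA : ∀ y : Perm (Fin n), ∀ x : Perm (Fin n), x ∈ alternatingGroup (Fin n) →
      (ρ₁ x : Matrix (Fin k) (Fin k) ℂ) * ρ₂ y = (ρ₂ y : Matrix (Fin k) (Fin k) ℂ) * ρ₁ x := by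
    intro y
    choose f hf using fun x => hω x y
    -- uniqueness of the scalar
    have huniq : ∀ x (d : ℂ), (ρ₁ x : Matrix (Fin k) (Fin k) ℂ) * ρ₂ y =
        d • ((ρ₂ y : Matrix (Fin k) (Fin k) ℂ) * ρ₁ x) → d = f x := by
      intro x d hd
      rw [hf x] at hd
      have hd' : f x • ((ρ₂ y * ρ₁ x : GL (Fin k) ℂ) : Matrix (Fin k) (Fin k) ℂ) =
          d • ((ρ₂ y * ρ₁ x : GL (Fin k) ℂ) : Matrix (Fin k) (Fin k) ℂ) := by
        rw [Units.val_mul]; exact hd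
      exact (smul_unit_injective hk _ hd').symm
    have hf1 : f 1 = 1 := (huniq 1 1 (by rw [map_one, Units.val_one, Matrix.one_mul,
      Matrix.mul_one, one_smul])).symm
    have hfmul : ∀ x x', f (x * x') = f x * f x' := by
      intro x x'
      symm
      apply huniq
      rw [map_mul, Units.val_mul, Matrix.mul_assoc, hf x', Matrix.mul_smul, ← Matrix.mul_assoc,
        hf x,
        Matrix.smul_mul, smul_smul, Matrix.mul_assoc, mul_comm (f x') (f x)]
    have hf0 : ∀ x, f x ≠ 0 := by
      intro x h0
      have := hfmul x x⁻¹
      rw [mul_inv_cancel, hf1, h0, zero_mul] at this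
      exact one_ne_zero this
    let F : Perm (Fin n) →* ℂˣ :=
      { toFun := fun x => Units.mk0 (f x) (hf0 x)
        map_one' := by ext; simp [hf1]
        map_mul' := fun x x' => by ext; simp [hfmul] }
    have hFker : alternatingGroup (Fin n) ≤ F.ker := by
      have h5 : 5 ≤ Nat.card (Fin n) := by
        rw [Nat.card_eq_fintype_card, Fintype.card_fin]; exact hn5
      calc alternatingGroup (Fin n) = ⁅alternatingGroup (Fin n), alternatingGroup (Fin n)⁆ :=
            (commutator_alternatingGroup_eq_self h5).symm
        _ ≤ ⁅(⊤ : Subgroup (Perm (Fin n))), ⊤⁆ := Subgroup.commutator_mono le_top le_top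
        _ = commutator (Perm (Fin n)) := (commutator_def _).symm
        _ ≤ F.ker := Abelianization.commutator_subset_ker F
    intro x hx
    have hFx : F x = 1 := hFker hx
    have hfx : f x = 1 := by
      have := congrArg (fun u : ℂˣ => (u : ℂ)) hFx
      simpa [F] using this
    rw [hf x, hfx, one_smul]
  -- `M(g) = ρ₁ x ρ₂ y` is multiplicative against `G₀` on the right
  set M : G → GL (Fin k) ℂ := fun g => ρ₁ (φ g).1 * ρ₂ (φ g).2 with hM
  have hMval : ∀ g : G, ((M g : GL (Fin k) ℂ) : Matrix (Fin k) (Fin k) ℂ) =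
      (ρ₁ (φ g).1 : Matrix (Fin k) (Fin k) ℂ) * ρ₂ (φ g).2 := fun g => Units.val_mul _ _
  have hMmul : ∀ g h : G, h ∈ G₀ → M (g * h) = M g * M h := by
    intro g h hh
    have hh' : (φ h).1 ∈ alternatingGroup (Fin n) := by
      rw [hG₀, Subgroup.mem_comap, hAA, Subgroup.mem_prod] at hh; exact hh.1
    apply Units.ext
    simp only [hM, map_mul, Prod.fst_mul, Prod.snd_mul, Units.val_mul]
    simp only [Matrix.mul_assoc]
    congr 1
    rw [← Matrix.mul_assoc, hcommA (φ g).2 (φ h).1 hh', Matrix.mul_assoc]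
  have hM1 : M 1 = 1 := by
    apply Units.ext; rw [hMval, map_one, Prod.fst_one, Prod.snd_one, map_one, map_one,
      Units.val_one, Matrix.mul_one]
  -- the scalar `c_g` with `ρ g = c_g • M g`
  set i₀ : Fin k := ⟨0, hk⟩ with hi₀
  set c : G → ℂ := fun g =>
    ((ρ g * (M g)⁻¹ : GL (Fin k) ℂ) : Matrix (Fin k) (Fin k) ℂ) i₀ i₀ with hc
  have hS : ∀ g : G, ((ρ g * (M g)⁻¹ : GL (Fin k) ℂ) : Matrix (Fin k) (Fin k) ℂ) =
      c g • (1 : Matrix (Fin k) (Fin k) ℂ) := by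
    intro g
    obtain ⟨d, -, hd⟩ := hρ g
    have h1 : ((ρ g * (M g)⁻¹ : GL (Fin k) ℂ) : Matrix (Fin k) (Fin k) ℂ) =
        d • (1 : Matrix (Fin k) (Fin k) ℂ) := by
      rw [Units.val_mul, hd, ← hMval, Matrix.smul_mul, Units.mul_inv]
    have hcd : c g = d := smul_one_apply_eq i₀ h1
    rw [hcd]; exact h1
  have hc0 : ∀ g : G, c g ≠ 0 := fun g => scalar_ne_zero_of_unit hk _ (hS g)
  have hρc : ∀ g : G, (ρ g : Matrix (Fin k) (Fin k) ℂ) =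
      c g • ((M g : GL (Fin k) ℂ) : Matrix (Fin k) (Fin k) ℂ) := by
    intro g
    have e : ρ g = ρ g * (M g)⁻¹ * M g := (inv_mul_cancel_right _ _).symm
    rw [e, Units.val_mul, hS g, Matrix.smul_mul, Matrix.one_mul]
  have hc1 : c 1 = 1 := by
    have h := hρc 1
    rw [map_one, hM1, Units.val_one] at h
    exact (smul_one_injective hk (by rw [one_smul]; exact h)).symm
  have hcmul : ∀ g h : G, h ∈ G₀ → c (g * h) = c g * c h := by
    intro g h hh
    apply smul_unit_injective hk (M (g * h))
    calc c (g * h) • ((M (g * h) : GL (Fin k) ℂ) : Matrix (Fin k) (Fin k) ℂ)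
        = (ρ (g * h) : Matrix (Fin k) (Fin k) ℂ) := (hρc _).symm
      _ = (ρ g : Matrix (Fin k) (Fin k) ℂ) * ρ h := by rw [map_mul, Units.val_mul]
      _ = (c g * c h) •
          (((M g : GL (Fin k) ℂ) : Matrix (Fin k) (Fin k) ℂ) * (M h : GL (Fin k) ℂ)) := by
          rw [hρc g, hρc h, Matrix.smul_mul, Matrix.mul_smul, smul_smul]
      _ = (c g * c h) • ((M (g * h) : GL (Fin k) ℂ) : Matrix (Fin k) (Fin k) ℂ) := by
          rw [hMmul g h hh, ← Units.val_mul]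
  -- the character `θ`
  let θ : G₀ →* ℂˣ :=
    { toFun := fun g => Units.mk0 (c g) (hc0 g)
      map_one' := by ext; simp [hc1]
      map_mul' := fun g h => by ext; simp [hcmul g h h.2] }
  refine ⟨θ, fun g hg => ?_⟩
  have hMg : M g = 1 := by
    apply Units.ext
    rw [hMval, hg, Prod.fst_one, Prod.snd_one, map_one, map_one, Units.val_one, Matrix.mul_one]
  have := hρc g
  rw [hMg, Units.val_one] at this
  exact this

end Summit.ValiantsHypothesis.ValiantsHypothesis.Theorems.SymPencilEquivariantSdcNotQP.SpinDichotomy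

end
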